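import Literature.InformationTheory.QuantumCodes.TwoBlockGAHypergraphProduct
import HarnessLib

/-!
# 2BGA codes with supports in subgroups `G_a, G_b ≤ G`, `G_a ∩ G_b = {1}`, `G_a G_b = G`, are hypergraph products —
# for an ARBITRARY finite group `G` (Lin–Pryadko 2024 §IV.C, internal form; corrected distance)

Topic `InformationTheory/QuantumCodes`; namespace `Literature.InformationTheory.QuantumCodes.TwoBlockGA`.
LADDER-QEC (cell `qec`), LIT-3 constructions, register A41 (qec-lit-3 gen 6). 0 named facts, no `sorry`.

Source followed. [LinPryadko2024] §IV.C (arXiv:2306.16400 chunk p0010 L53–79): Statement 8 places `LP[a,b]` over a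
group containing the support groups `G_a = ⟨supp a⟩`, `G_b = ⟨supp b⟩` with `N = G_a ∩ G_b` central; «In particular,
with disjoint subgroups, `G_a ∩ G_b = {1}`, the group in Statement 8 is just a direct product of the two subgroups,
`G' = G_a × G_b` … `A = A₁ ⊗ I_{n_b}`, `B = I_{n_a} ⊗ B₁` … This is exactly the block structure of an HP code».

This file types the INTERNAL version for an arbitrary finite group `G` that is the product SET of two subgroups with
trivial intersection (`|G_a|·|G_b| = |G|`; no normality or commutativity is needed — a Zappa–Szép product suffices,
the direct product `G_a × G_b` of the printed sentence being the case where both are normal): the multiplication map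
`σ : G_a × G_b → G`, `(α, β) ↦ αβ`, is a bijection, and along `σ` (on checks and on both qubit blocks)

* `HX_submatrix_mulEquiv`, `HZ_submatrix_mulEquiv` — the check matrices of `LP[a,b]` over `G` ARE those of the
  external code `LP[a|_{G_a} ⊗ 1, 1 ⊗ b|_{G_b}]` over `G_a × G_b` (`TwoBlockGAHypergraphProduct.lean`), because left
  multiplication by `G_a` moves only the `α`-factor of `αβ` and right multiplication by `G_b` only the `β`-factor;
* ★ `css_isCode_of_disjoint_supports` — hence **`LP[a,b]` is a
  `[[2|G_a||G_b|, 2 k_a k_b, min(d_a, d_aᵀ, d_b, d_bᵀ)]]` code** (`k_a, k_b > 0`; classical codes of `L_{G_a}(a)`,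
  `R_{G_b}(b)` and their transposes) — the printed `min(d_a, d_b)` being the abelian case
  (`GroupAlgebraCodeTransposeDistance.lean` for why the transposes are needed in general).

## References

* [LinPryadko2024] Lin–Pryadko, arXiv:2306.16400, §IV.C Statement 8 and the disjoint-subgroup paragraph (chunk p0010
  L53–79); §IV.B Thm 6 (permutation equivalence preserves parameters; tree `CSSEquivalence.lean`
  `CSSCode.isCode_iff_of_submatrix`).
* [TillichZemor2014] Tillich–Zémor, arXiv:0903.0566, Thms 7, 9 (tree `HypergraphProduct*.lean`).
-/

namespace Literature.InformationTheory.QuantumCodes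

open Matrix Module
open Literature.InformationTheory.Coding (minDist)

namespace TwoBlockGA

variable {G : Type*} [Group G] [Fintype G] [DecidableEq G]
variable (Ha Hb : Subgroup G) [DecidablePred (· ∈ Ha)] [DecidablePred (· ∈ Hb)]

/-- The multiplication map `G_a × G_b → G`, `(α, β) ↦ αβ`. (definition)
[cite: LinPryadko2024, §IV.C «we can independently choose the order of elements in each subgroup» (arXiv:2306.16400 chunk p0010 L68–70)] -/
def mulMap : Ha × Hb → G := fun p => (p.1 : G) * p.2

omit [Fintype G] [DecidableEq G] [DecidablePred (· ∈ Ha)] [DecidablePred (· ∈ Hb)] in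
/-- [cite: LinPryadko2024, §IV.C (arXiv:2306.16400 chunk p0010 L68–70)] -/
@[simp] theorem mulMap_apply (p : Ha × Hb) : mulMap Ha Hb p = (p.1 : G) * p.2 := rfl

omit [Fintype G] [DecidableEq G] [DecidablePred (· ∈ Ha)] [DecidablePred (· ∈ Hb)] in
/-- `(α, β) ↦ αβ` is injective when `G_a ∩ G_b = {1}`. [cite: LinPryadko2024, §IV.C «G_a ∩ G_b = {1}» (arXiv:2306.16400 chunk p0010 L66–68)] -/
theorem mulMap_injective (hdis : Disjoint Ha Hb) : Function.Injective (mulMap Ha Hb) := by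
  rintro ⟨α, β⟩ ⟨α', β'⟩ h
  simp only [mulMap_apply] at h
  -- `α'⁻¹ α = β' β⁻¹` lies in both subgroups, hence is `1`
  have hx : ((α' : G)⁻¹ * α : G) = β' * (β : G)⁻¹ := by
    calc ((α' : G)⁻¹ * α : G) = (α' : G)⁻¹ * ((α : G) * β) * (β : G)⁻¹ := by group
      _ = (α' : G)⁻¹ * ((α' : G) * β') * (β : G)⁻¹ := by rw [h]
      _ = β' * (β : G)⁻¹ := by group
  have hmemA : ((α' : G)⁻¹ * α : G) ∈ Ha := Ha.mul_mem (Ha.inv_mem α'.2) α.2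
  have hmemB : ((α' : G)⁻¹ * α : G) ∈ Hb := by rw [hx]; exact Hb.mul_mem β'.2 (Hb.inv_mem β.2)
  have h1 : ((α' : G)⁻¹ * α : G) = 1 := Subgroup.disjoint_def.mp hdis hmemA hmemB
  have hαα : (α' : G) = α := inv_mul_eq_one.mp h1
  have hββ : (β' : G) = β := mul_inv_eq_one.mp (by rw [← hx, h1])
  exact Prod.ext (Subtype.ext hαα.symm) (Subtype.ext hββ.symm)

/-- The bijection `σ : G_a × G_b ≃ G` when `G_a ∩ G_b = {1}` and `|G_a|·|G_b| = |G|`. (definition)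
[cite: LinPryadko2024, §IV.C (arXiv:2306.16400 chunk p0010 L66–70)] -/
noncomputable def mulEquiv (hdis : Disjoint Ha Hb) (hcard : Fintype.card Ha * Fintype.card Hb = Fintype.card G) :
    Ha × Hb ≃ G :=
  Equiv.ofBijective (mulMap Ha Hb)
    ((Fintype.bijective_iff_injective_and_card _).mpr ⟨mulMap_injective Ha Hb hdis, by rw [Fintype.card_prod, hcard]⟩)

omit [DecidableEq G] in
/-- [cite: LinPryadko2024, §IV.C (arXiv:2306.16400 chunk p0010 L66–70)] -/
@[simp] theorem mulEquiv_apply (hdis : Disjoint Ha Hb) (hcard : Fintype.card Ha * Fintype.card Hb = Fintype.card G)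
    (p : Ha × Hb) : mulEquiv Ha Hb hdis hcard p = (p.1 : G) * p.2 := rfl

omit [Fintype G] [DecidableEq G] [DecidablePred (· ∈ Ha)] [DecidablePred (· ∈ Hb)] in
/-- Key computation: for `α, α' ∈ G_a`, `x ∈ G_b`: `α x α'⁻¹ ∈ G_a ↔ x = 1` (trivial intersection). [folklore] -/
private theorem conj_mem_iff (hdis : Disjoint Ha Hb) (α α' : Ha) {x : G} (hx : x ∈ Hb) :
    ((α : G) * x * (α' : G)⁻¹ ∈ Ha) ↔ x = 1 := by
  rw [Ha.mul_mem_cancel_right (Ha.inv_mem α'.2), Ha.mul_mem_cancel_left α.2]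
  exact ⟨fun h => Subgroup.disjoint_def.mp hdis h hx, fun h => h ▸ Ha.one_mem⟩

omit [Fintype G] [DecidableEq G] [DecidablePred (· ∈ Ha)] [DecidablePred (· ∈ Hb)] in
/-- … and symmetrically `β'⁻¹ y β ∈ G_b ↔ y = 1` for `β, β' ∈ G_b`, `y ∈ G_a`. [folklore] -/
private theorem conj_mem_iff' (hdis : Disjoint Ha Hb) (β β' : Hb) {y : G} (hy : y ∈ Ha) :
    ((β' : G)⁻¹ * y * (β : G) ∈ Hb) ↔ y = 1 := by
  rw [Hb.mul_mem_cancel_right β.2, Hb.mul_mem_cancel_left (Hb.inv_mem β'.2)]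
  exact ⟨fun h => Subgroup.disjoint_def.mp hdis hy h, fun h => h ▸ Hb.one_mem⟩

/-- **`H_X(LP[a,b]) = H_X(LP[a|⊗1, 1⊗b|])` along `σ`** (checks by `σ`, both qubit blocks by `σ`), for `supp a ⊆ G_a`,
`supp b ⊆ G_b`. [cite: LinPryadko2024, §IV.C «A = A₁ ⊗ I_{n_b}, B = I_{n_a} ⊗ B₁» (arXiv:2306.16400 chunk p0010 L69–72)] -/
theorem HX_submatrix_mulEquiv (hdis : Disjoint Ha Hb) (hcard : Fintype.card Ha * Fintype.card Hb = Fintype.card G)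
    (a b : G → ZMod 2) (ha : ∀ g, g ∉ Ha → a g = 0) (hb : ∀ g, g ∉ Hb → b g = 0) :
    (css (prodInl fun α : Ha => a α) (prodInr fun β : Hb => b β)).HX =
      (css a b).HX.submatrix (mulEquiv Ha Hb hdis hcard)
        (Equiv.sumCongr (mulEquiv Ha Hb hdis hcard) (mulEquiv Ha Hb hdis hcard)) := by
  ext ⟨α, β⟩ (⟨α', β'⟩ | ⟨α', β'⟩)
  · -- left block: `a((αβ)(α'β')⁻¹) = [β = β'] · a(αα'⁻¹)`
    simp only [css_HX, HX_apply_inl, submatrix_apply, Equiv.sumCongr_apply, Sum.map_inl, mulEquiv_apply,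
      prodInl_apply, Prod.snd_mul, Prod.snd_inv, Prod.fst_mul, Prod.fst_inv, Subgroup.coe_mul, Subgroup.coe_inv]
    have hrw : (α : G) * β * ((α' : G) * β')⁻¹ = α * (β * (β' : G)⁻¹) * (α' : G)⁻¹ := by group
    rw [hrw]
    split_ifs with h
    · have hb' : β = β' := mul_inv_eq_one.mp h
      subst hb'
      rw [mul_inv_cancel, mul_one]
    · refine (ha _ fun hmem => h ?_).symm
      have h1 := (conj_mem_iff Ha Hb hdis α α' (Hb.mul_mem β.2 (Hb.inv_mem β'.2))).mp hmem
      exact mul_inv_eq_one.mpr (Subtype.ext (mul_inv_eq_one.mp h1))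
  · -- right block: `b((α'β')⁻¹(αβ)) = [α = α'] · b(β'⁻¹β)`
    simp only [css_HX, HX_apply_inr, submatrix_apply, Equiv.sumCongr_apply, Sum.map_inr, mulEquiv_apply,
      prodInr_apply, Prod.snd_mul, Prod.snd_inv, Prod.fst_mul, Prod.fst_inv, Subgroup.coe_mul, Subgroup.coe_inv]
    have hrw : ((α' : G) * β')⁻¹ * ((α : G) * β) = (β' : G)⁻¹ * ((α' : G)⁻¹ * α) * β := by group
    rw [hrw]
    split_ifs with h
    · have ha' : α' = α := inv_mul_eq_one.mp h
      subst ha'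
      rw [inv_mul_cancel, mul_one]
    · refine (hb _ fun hmem => h ?_).symm
      have h1 := (conj_mem_iff' Ha Hb hdis β β' (Ha.mul_mem (Ha.inv_mem α'.2) α.2)).mp hmem
      exact inv_mul_eq_one.mpr (Subtype.ext (inv_mul_eq_one.mp h1))

/-- **`H_Z(LP[a,b]) = H_Z(LP[a|⊗1, 1⊗b|])` along `σ`.** [cite: LinPryadko2024, §IV.C (arXiv:2306.16400 chunk p0010 L69–72)] -/
theorem HZ_submatrix_mulEquiv (hdis : Disjoint Ha Hb) (hcard : Fintype.card Ha * Fintype.card Hb = Fintype.card G)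
    (a b : G → ZMod 2) (ha : ∀ g, g ∉ Ha → a g = 0) (hb : ∀ g, g ∉ Hb → b g = 0) :
    (css (prodInl fun α : Ha => a α) (prodInr fun β : Hb => b β)).HZ =
      (css a b).HZ.submatrix (mulEquiv Ha Hb hdis hcard)
        (Equiv.sumCongr (mulEquiv Ha Hb hdis hcard) (mulEquiv Ha Hb hdis hcard)) := by
  ext ⟨α, β⟩ (⟨α', β'⟩ | ⟨α', β'⟩)
  · -- left block of `H_Z`: `b((αβ)⁻¹(α'β')) = [α = α'] · b(β⁻¹β')`
    simp only [css_HZ, HZ_apply_inl, submatrix_apply, Equiv.sumCongr_apply, Sum.map_inl, mulEquiv_apply,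
      prodInr_apply, Prod.snd_mul, Prod.snd_inv, Prod.fst_mul, Prod.fst_inv, Subgroup.coe_mul, Subgroup.coe_inv]
    have hrw : ((α : G) * β)⁻¹ * ((α' : G) * β') = (β : G)⁻¹ * ((α : G)⁻¹ * α') * β' := by group
    rw [hrw]
    split_ifs with h
    · have ha' : α = α' := inv_mul_eq_one.mp h
      subst ha'
      rw [inv_mul_cancel, mul_one]
    · refine (hb _ fun hmem => h ?_).symm
      have h1 := (conj_mem_iff' Ha Hb hdis β' β (Ha.mul_mem (Ha.inv_mem α.2) α'.2)).mp hmem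
      exact inv_mul_eq_one.mpr (Subtype.ext (inv_mul_eq_one.mp h1))
  · -- right block of `H_Z`: `a((α'β')(αβ)⁻¹) = [β' = β] · a(α'α⁻¹)`
    simp only [css_HZ, HZ_apply_inr, submatrix_apply, Equiv.sumCongr_apply, Sum.map_inr, mulEquiv_apply,
      prodInl_apply, Prod.snd_mul, Prod.snd_inv, Prod.fst_mul, Prod.fst_inv, Subgroup.coe_mul, Subgroup.coe_inv]
    have hrw : (α' : G) * β' * ((α : G) * β)⁻¹ = α' * (β' * (β : G)⁻¹) * (α : G)⁻¹ := by group
    rw [hrw]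
    split_ifs with h
    · have hb' : β' = β := mul_inv_eq_one.mp h
      subst hb'
      rw [mul_inv_cancel, mul_one]
    · refine (ha _ fun hmem => h ?_).symm
      have h1 := (conj_mem_iff Ha Hb hdis α' α (Hb.mul_mem β'.2 (Hb.inv_mem β.2))).mp hmem
      exact mul_inv_eq_one.mpr (Subtype.ext (mul_inv_eq_one.mp h1))

/-- ★ **Lin–Pryadko §IV.C, internal form, any finite group, corrected distance:** if `supp a ⊆ G_a`, `supp b ⊆ G_b`
for subgroups with `G_a ∩ G_b = {1}` and `|G_a|·|G_b| = |G|`, then `LP[a,b]` over `G` is a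
`[[2|G_a||G_b|, 2 k_a k_b, min(d_a, d_aᵀ, d_b, d_bᵀ)]]` code (`k_a, k_b > 0`), the classical codes being those of
`L_{G_a}(a)`, `R_{G_b}(b)` and their transposes (census predicate `IsCode`, exact distance).
[cite: LinPryadko2024, §IV.C «[[2n_an_b, 2k_ak_b, min(d_a,d_b)]]_q» (arXiv:2306.16400 chunk p0010 L66–79) — printed distance = abelian case] [cite: TillichZemor2014, Thm 9 (arXiv v1 chunk p0008 L11-15)] -/
theorem css_isCode_of_disjoint_supports (hdis : Disjoint Ha Hb)
    (hcard : Fintype.card Ha * Fintype.card Hb = Fintype.card G) (a b : G → ZMod 2)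
    (ha : ∀ g, g ∉ Ha → a g = 0) (hb : ∀ g, g ∉ Hb → b g = 0) {ka kb da daT db dbT : ℕ}
    (hka : finrank (ZMod 2) (pcCode (leftMul fun α : Ha => a α)) = ka)
    (hkb : finrank (ZMod 2) (pcCode (rightMul fun β : Hb => b β)) = kb) (hka0 : 0 < ka) (hkb0 : 0 < kb)
    (hda : minDist (pcCode (leftMul fun α : Ha => a α)) = da)
    (hdaT : minDist (pcCode (leftMul fun α : Ha => a α)ᵀ) = daT)
    (hdb : minDist (pcCode (rightMul fun β : Hb => b β)) = db)
    (hdbT : minDist (pcCode (rightMul fun β : Hb => b β)ᵀ) = dbT) :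
    (css a b).IsCode (2 * Fintype.card Ha * Fintype.card Hb) (2 * ka * kb) (min (min daT dbT) (min da db)) :=
  (CSSCode.isCode_iff_of_submatrix (HX_submatrix_mulEquiv Ha Hb hdis hcard a b ha hb)
      (HZ_submatrix_mulEquiv Ha Hb hdis hcard a b ha hb) _ _ _).mp
    (css_prod_isCode _ _ hka hkb hka0 hkb0 hda hdaT hdb hdbT)

end TwoBlockGA

end Literature.InformationTheory.QuantumCodes
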